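import Summits.ResolutionOfSingularities.ResolutionOfSingularities.Theorems.FrobeniusLadderFInjectiveMacaulayficationCIChartPresentationKernel
import Summits.ResolutionOfSingularities.ResolutionOfSingularities.Theorems.FrobeniusLadderFInjectiveMacaulayficationCIChartCore
import Summits.ResolutionOfSingularities.ResolutionOfSingularities.Theorems.FrobeniusLadderFInjectiveMacaulayficationBlowupFiModelOfCover
import Mathlib.RingTheory.Localization.Ideal
import Mathlib.RingTheory.Localization.AtPrime.Basic
import HarnessLib

/-!
# CI chart presentation (C1ᶜⁱ), part 3: the LOCAL presentation — the saturation binder discharged from the expected dimension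
# (crux `FInjectiveMacaulayfication`, CI-CN engine kernel, CRUX-PLAN w45a v8 R9.1 piece C1ᶜⁱ; seat res-L1-w45a-stub-1)

[OURS · L1 W4.5a] Support file for crux stmt-ResolutionOfSingularities-15315. AI-written, weaker than expert review; no statement of
[claim: Hironaka2017] is used. Continues `CIChartPresentationRange` / `CIChartPresentationKernel`: complete intersection
`F = (F₁, …, F_c) ⊆ k[X]`, `R = k[X]/F`, chart data `V` (unimodular), `m`, `a i`, `A`, strict transforms `θ Fᵢ = Y^{dᵢ} gᵢ`, chart map
`Ψ_F : k[Y] → R[1/x̄^m]` whose image is the chart ring `B = R[I_A R/x̄^m]` of the strict transform of `X = V(F)`.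

Part 2 presented `B` as `k[Y]/(g₁, …, g_c)` under the GLOBAL saturation binder `Y^e h ∈ (g) ⇒ h ∈ (g)`. Here the binder is replaced by what
the CI-CN engine actually has at a chart POINT (tri-1 §19 F17): the EXPECTED DIMENSION of the «initial complete intersection».

* §1 `isSMulRegular_of_expectedDim` — in a regular local ring `S`, if `gs, ys ⊆ 𝔪` and `dim S⧸(gs ++ ys) + |gs| + |ys| = dim S`, then
  EVERY `y ∈ ys` is a non-zero-divisor on `S ⧸ (gs)`. No unmixedness theorem is used: `gs ++ (y :: ys∖y)` generates the same ideal as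
  `gs ++ ys`, so it too is weakly regular (res-L1-w45a-stub-6's `CIChartCore.isWeaklyRegular_of_ringKrullDim_quotient`, i.e. extension to a
  system of parameters + Matsumura 17.4 (iii)), and its `(|gs|+1)`-st member `y` is regular on `S ⧸ (gs)`.
* §2 THE LOCAL PRESENTATION OF THE STRICT TRANSFORM: `exists_corestriction` — a surjection `φ : k[Y] ↠ B`, the corestriction of `Ψ_F`;
  `span_le_ker_and_sat` — `(g₁, …, g_c) ⊆ ker φ ⊆ ((g₁, …, g_c) : Y^∞)`; `nonempty_localization_ringEquiv_quotient` (abstract) and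
  `nonempty_localization_ringEquiv` — for every prime `Q` of `B` with contraction `Q̃ = φ⁻¹ Q ⊆ k[Y]`, `S = k[Y]_Q̃`: IF every variable
  `Yᵢ ∈ Q̃` is a non-zero-divisor on `S ⧸ (g₁, …, g_c)S` (the variables outside `Q̃` are units of `S`), THEN `B_Q ≃+* S ⧸ (g₁, …, g_c)S` —
  the `S ⧸ Ideal.ofList gs` of `CIChartCore.ciChartCore'`. By §1 the hypothesis holds as soon as `gs` and the orbit coordinates
  `ys ⊇ (Yᵢ : Yᵢ ∈ Q̃)` have the expected dimension in the regular local ring `S` (the same hypothesis `ciChartCore'` consumes) —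
  `isSMulRegular_algebraMap_X_of_expectedDim` packages this.
No definition is declared. [folklore: localisation is exact; strict transform = saturation of the total transform]
-/

set_option linter.dupNamespace false

noncomputable section

open MvPolynomial IsLocalRing RingTheory.Sequence Literature.RingTheory.TightClosure Literature.AlgebraicGeometry.Resolution

namespace Summit.ResolutionOfSingularities.ResolutionOfSingularities.Theorems.FInjectiveMacaulayfication.CIChartPresentationLocal

open Summit.ResolutionOfSingularities.ResolutionOfSingularities.Theorems.FInjectiveMacaulayfication

/-! ## §1 Expected dimension ⇒ every orbit coordinate is a non-zero-divisor modulo the strict transforms -/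

section ExpectedDim

variable {S : Type} [CommRing S]

/-- Permuting a list does not change the ideal it generates. [folklore] -/
theorem ofList_eq_of_perm {l₁ l₂ : List S} (h : l₁.Perm l₂) : Ideal.ofList l₁ = Ideal.ofList l₂ := by
  change Ideal.span {r | r ∈ l₁} = Ideal.span {r | r ∈ l₂}
  congr 1
  ext r
  exact h.mem_iff

variable [IsRegularLocalRing S]

/-- **Expected dimension ⇒ the orbit coordinates are non-zero-divisors modulo the strict transforms.** In a regular local ring `S`, let
`gs, ys ⊆ 𝔪` with `dim S⧸(gs ++ ys) + |gs| + |ys| = dim S`. Then every `y ∈ ys` is a non-zero-divisor on `S ⧸ (gs)`: the reordered list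
`gs ++ (y :: ys∖y)` generates the same ideal, hence is weakly regular on `S` (`CIChartCore.isWeaklyRegular_of_ringKrullDim_quotient`), and
`y` is its first member after `gs`. [folklore; Matsumura 17.4 (iii)] -/
theorem isSMulRegular_of_expectedDim (gs ys : List S) (hgs : ∀ g ∈ gs, g ∈ maximalIdeal S)
    (hys : ∀ y ∈ ys, y ∈ maximalIdeal S)
    (hdim : ringKrullDim (S ⧸ Ideal.ofList (gs ++ ys)) + ((gs.length + ys.length : ℕ) : WithBot ℕ∞) = ringKrullDim S)
    (y : S) (hy : y ∈ ys) : IsSMulRegular (S ⧸ Ideal.ofList gs) y := by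
  classical
  set L := gs ++ ys with hL_def
  set L' := gs ++ (y :: ys.erase y) with hL'_def
  have hperm : L'.Perm L := List.Perm.append_left gs (List.perm_cons_erase hy).symm
  have hI : Ideal.ofList L' = Ideal.ofList L := ofList_eq_of_perm hperm
  have hlen : L'.length = L.length := hperm.length_eq
  have hL : ∀ x ∈ L, x ∈ maximalIdeal S := by
    intro x hx
    rcases List.mem_append.mp hx with hx | hx
    · exact hgs x hx
    · exact hys x hx
  have hL' : ∀ x ∈ L', x ∈ maximalIdeal S := fun x hx => hL x (hperm.mem_iff.mp hx)
  -- `dim S⧸(L) = e`, `dim S = |L'| + e`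
  obtain ⟨-, hnt, hloc⟩ := CIChartCore.isLocalRing_quotient_ofList L hL
  obtain ⟨e, he⟩ := exists_nat_cast_eq_ringKrullDim (R := S ⧸ Ideal.ofList L)
  have hdimS : ringKrullDim S = ((L'.length + e : ℕ) : WithBot ℕ∞) := by
    rw [hlen, ← hdim, he, hL_def, List.length_append]
    push_cast
    ring
  have hquot : ringKrullDim (S ⧸ Ideal.ofList L') = (e : WithBot ℕ∞) := by
    rw [hI]; exact he
  -- `L'` is weakly regular on `S`; its member `y` right after `gs` is regular on `S ⧸ (gs)`
  have hw : IsWeaklyRegular S L' := CIChartCore.isWeaklyRegular_of_ringKrullDim_quotient L' hL' e hdimS hquot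
  have hw₂ := ((isWeaklyRegular_append_iff S gs (y :: ys.erase y)).mp hw).2
  have hy' := ((isWeaklyRegular_cons_iff _ y (ys.erase y)).mp hw₂).1
  have heq : (Ideal.ofList gs • ⊤ : Submodule S S) = Ideal.ofList gs := by rw [smul_eq_mul, Ideal.mul_top]
  exact ((Submodule.quotEquivOfEq _ _ heq).isSMulRegular_congr y).mp hy'

end ExpectedDim

/-! ## §2 The local presentation of the strict transform -/

section Chart

variable {n : ℕ} {k : Type} [Field k] (V : Matrix (Fin n) (Fin n) ℕ)
  (hV : IsUnit (V.map (Nat.cast : ℕ → ℤ)).det) (m : Fin n →₀ ℕ) (a : Fin n → (Fin n →₀ ℕ))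
  (hgen : ∀ i : Fin n, (Finsupp.equivFunOnFinite.symm (V.mulVec ⇑(a i)) : Fin n →₀ ℕ) =
    Finsupp.equivFunOnFinite.symm (V.mulVec ⇑m) + Finsupp.single i 1)
  (A : Finset (Fin n →₀ ℕ)) (haA : ∀ i, a i ∈ A)
  (hge : ∀ e ∈ A, (Finsupp.equivFunOnFinite.symm (V.mulVec ⇑m) : Fin n →₀ ℕ) ≤
    Finsupp.equivFunOnFinite.symm (V.mulVec ⇑e))
  {c : ℕ} (Fs gs : Fin c → MvPolynomial (Fin n) k) (d : Fin c → (Fin n →₀ ℕ))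
  (hθF : ∀ i : Fin c, aeval (fun j : Fin n => ∏ l : Fin n, (X l : MvPolynomial (Fin n) k) ^ V l j) (Fs i) =
    monomial (d i) (1 : k) * gs i)
  (hunit : ∀ i : Fin c, ∃ (N : ℕ) (r : Fin n →₀ ℕ), N • m = ∑ j : Fin n, d i j • a j + r)

/-- **Monomials are non-zero-divisors** on `S ⧸ G·S`, `S = k[Y]_Q̃`, as soon as the variables IN `Q̃` are (the variables outside `Q̃`
are units of `S`). [folklore] -/
theorem isSMulRegular_monomial (Q : Ideal (MvPolynomial (Fin n) k)) [Q.IsPrime] (G : Ideal (MvPolynomial (Fin n) k))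
    (hX : ∀ i : Fin n, (X i : MvPolynomial (Fin n) k) ∈ Q →
      IsSMulRegular (Localization.AtPrime Q ⧸ G.map (algebraMap (MvPolynomial (Fin n) k) (Localization.AtPrime Q)))
        (algebraMap (MvPolynomial (Fin n) k) (Localization.AtPrime Q) (X i)))
    (e : Fin n →₀ ℕ) :
    IsSMulRegular (Localization.AtPrime Q ⧸ G.map (algebraMap (MvPolynomial (Fin n) k) (Localization.AtPrime Q)))
      (algebraMap (MvPolynomial (Fin n) k) (Localization.AtPrime Q) (monomial e (1 : k))) := by
  classical
  set S := Localization.AtPrime Q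
  set f := algebraMap (MvPolynomial (Fin n) k) S
  have hXreg : ∀ i : Fin n, IsSMulRegular (S ⧸ G.map f) (f (X i)) := by
    intro i
    by_cases hi : (X i : MvPolynomial (Fin n) k) ∈ Q
    · exact hX i hi
    · exact (IsLocalization.map_units S (⟨X i, hi⟩ : Q.primeCompl)).isSMulRegular (S ⧸ G.map f)
  rw [monomial_eq, C_1, one_mul, Finsupp.prod, map_prod]
  refine Finset.prod_induction _ (fun s => IsSMulRegular (S ⧸ G.map f) s) (fun x y hx hy => hx.mul hy)
    (IsSMulRegular.one _) ?_
  intro i _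
  rw [map_pow]
  exact (hXreg i).pow (e i)

/-- **Localisation of a quotient of `k[Y]` at a prime, modulo a monomial-saturated kernel.** Let `φ : k[Y] ↠ B'` be surjective and
`G ⊆ ker φ ⊆ (G : Y^∞)` (every element of the kernel is multiplied into `G` by a monomial). For a prime `Q` of `B'` with contraction
`Q̃ = φ⁻¹ Q` and `S = k[Y]_Q̃`: if every variable `Yᵢ ∈ Q̃` is a non-zero-divisor on `S ⧸ G·S`, then `B'_Q ≃+* S ⧸ G·S`. Proof: `B' ≅ k[Y]/ker φ`,
localisation commutes with quotients (`(k[Y]/P)_{Q/P} ≅ S ⧸ P·S`), and `(ker φ)·S = G·S` because monomials are non-zero-divisors modulo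
`G·S` (`isSMulRegular_monomial`). [folklore] -/
theorem nonempty_localization_ringEquiv_quotient {B' : Type} [CommRing B'] (φ : MvPolynomial (Fin n) k →+* B')
    (hsurj : Function.Surjective φ) (G : Ideal (MvPolynomial (Fin n) k)) (hGle : G ≤ RingHom.ker φ)
    (hsat : ∀ h ∈ RingHom.ker φ, ∃ e : Fin n →₀ ℕ, monomial e (1 : k) * h ∈ G) (Q : Ideal B') [Q.IsPrime]
    (hX : ∀ i : Fin n, (X i : MvPolynomial (Fin n) k) ∈ Q.comap φ →
      IsSMulRegular (Localization.AtPrime (Q.comap φ) ⧸ G.map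
          (algebraMap (MvPolynomial (Fin n) k) (Localization.AtPrime (Q.comap φ))))
        (algebraMap (MvPolynomial (Fin n) k) (Localization.AtPrime (Q.comap φ)) (X i))) :
    Nonempty (Localization.AtPrime Q ≃+*
      Localization.AtPrime (Q.comap φ) ⧸ G.map (algebraMap (MvPolynomial (Fin n) k) (Localization.AtPrime (Q.comap φ)))) := by
  classical
  haveI : (Q.comap φ).IsPrime := Ideal.comap_isPrime φ Q
  -- (1) `B' ≅ k[Y] ⧸ P`, and `Q` corresponds to `Q' ⊆ k[Y] ⧸ P` lying over `Q.comap φ`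
  let eB : (MvPolynomial (Fin n) k ⧸ RingHom.ker φ) ≃+* B' := RingHom.quotientKerEquivOfSurjective hsurj
  let Q' : Ideal (MvPolynomial (Fin n) k ⧸ RingHom.ker φ) := Q.comap eB.toRingHom
  haveI hQ'p : Q'.IsPrime := Ideal.comap_isPrime _ _
  have hQ'Qt : Q'.comap (Ideal.Quotient.mk (RingHom.ker φ)) = Q.comap φ := by
    ext x
    change eB (Ideal.Quotient.mk (RingHom.ker φ) x) ∈ Q ↔ φ x ∈ Q
    rw [RingHom.quotientKerEquivOfSurjective_apply_mk]
  obtain ⟨ε₁⟩ := BlowupFiModelOfCover.nonempty_ringEquiv_localization_of_ringEquiv eB.symm Q Q' (fun x => by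
    change eB (eB.symm x) ∈ Q ↔ x ∈ Q
    rw [RingEquiv.apply_symm_apply])
  -- (2) `(k[Y] ⧸ P)_{Q'} ≅ S ⧸ P·S` (localisation commutes with quotients)
  have hsub : Algebra.algebraMapSubmonoid (MvPolynomial (Fin n) k ⧸ RingHom.ker φ) (Q.comap φ).primeCompl = Q'.primeCompl := by
    ext x
    refine ⟨?_, fun hx => ?_⟩
    · rintro ⟨y, hy, rfl⟩ hyQ'
      refine hy ?_
      rw [← hQ'Qt]
      exact hyQ'
    · obtain ⟨y, rfl⟩ := Ideal.Quotient.mk_surjective x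
      refine ⟨y, fun hyQ => hx ?_, rfl⟩
      rw [← hQ'Qt] at hyQ
      exact hyQ
  have hL : IsLocalization Q'.primeCompl (Localization.AtPrime (Q.comap φ) ⧸ (RingHom.ker φ).map
      (algebraMap (MvPolynomial (Fin n) k) (Localization.AtPrime (Q.comap φ)))) := by
    have h : IsLocalization (Algebra.algebraMapSubmonoid (MvPolynomial (Fin n) k ⧸ RingHom.ker φ) (Q.comap φ).primeCompl)
        (Localization.AtPrime (Q.comap φ) ⧸ (RingHom.ker φ).map
          (algebraMap (MvPolynomial (Fin n) k) (Localization.AtPrime (Q.comap φ)))) := inferInstance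
    rwa [hsub] at h
  let ε₂ : Localization.AtPrime Q' ≃+* Localization.AtPrime (Q.comap φ) ⧸ (RingHom.ker φ).map
      (algebraMap (MvPolynomial (Fin n) k) (Localization.AtPrime (Q.comap φ))) :=
    (IsLocalization.algEquiv Q'.primeCompl (Localization.AtPrime Q') (Localization.AtPrime (Q.comap φ) ⧸ (RingHom.ker φ).map
      (algebraMap (MvPolynomial (Fin n) k) (Localization.AtPrime (Q.comap φ))))).toRingEquiv
  -- (3) `P·S = G·S`: monomials are non-zero-divisors modulo `G·S`
  have hPG : (RingHom.ker φ).map (algebraMap (MvPolynomial (Fin n) k) (Localization.AtPrime (Q.comap φ))) =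
      G.map (algebraMap (MvPolynomial (Fin n) k) (Localization.AtPrime (Q.comap φ))) := by
    refine le_antisymm ?_ (Ideal.map_mono hGle)
    rw [Ideal.map_le_iff_le_comap]
    intro h hh
    obtain ⟨e, he⟩ := hsat h hh
    have hreg := isSMulRegular_monomial (Q.comap φ) G hX e
    rw [Ideal.mem_comap, ← Ideal.Quotient.eq_zero_iff_mem]
    have h1 : algebraMap (MvPolynomial (Fin n) k) (Localization.AtPrime (Q.comap φ)) (monomial e (1 : k)) •
        Ideal.Quotient.mk (G.map (algebraMap (MvPolynomial (Fin n) k) (Localization.AtPrime (Q.comap φ))))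
          (algebraMap (MvPolynomial (Fin n) k) (Localization.AtPrime (Q.comap φ)) h) = 0 := by
      change Ideal.Quotient.mk _ (algebraMap (MvPolynomial (Fin n) k) (Localization.AtPrime (Q.comap φ)) (monomial e (1 : k)) *
        algebraMap (MvPolynomial (Fin n) k) (Localization.AtPrime (Q.comap φ)) h) = 0
      rw [← map_mul, Ideal.Quotient.eq_zero_iff_mem]
      exact Ideal.mem_map_of_mem _ he
    have h2 : algebraMap (MvPolynomial (Fin n) k) (Localization.AtPrime (Q.comap φ)) (monomial e (1 : k)) •
        Ideal.Quotient.mk (G.map (algebraMap (MvPolynomial (Fin n) k) (Localization.AtPrime (Q.comap φ))))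
          (algebraMap (MvPolynomial (Fin n) k) (Localization.AtPrime (Q.comap φ)) h) =
        algebraMap (MvPolynomial (Fin n) k) (Localization.AtPrime (Q.comap φ)) (monomial e (1 : k)) •
        (0 : Localization.AtPrime (Q.comap φ) ⧸ G.map (algebraMap (MvPolynomial (Fin n) k) (Localization.AtPrime (Q.comap φ)))) := by
      rw [h1, smul_zero]
    exact hreg h2
  -- (4) compose
  exact ⟨ε₁.trans (ε₂.trans (Ideal.quotEquivOfEq hPG))⟩

include hV hgen haA hge in
/-- **The corestriction of the chart map**: a surjection `φ : k[Y] ↠ B = R[I_A R/x̄^m]` with `φ q = Ψ_F q`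
(`CIChartPresentationRange.range_psi_eq_blowupAlgebra`). [folklore] -/
theorem exists_corestriction :
    ∃ φ : MvPolynomial (Fin n) k →+* ↥(blowupAlgebra
          (Ideal.span ((fun e : Fin n →₀ ℕ => Ideal.Quotient.mk (Ideal.span (Set.range Fs)) (monomial e (1 : k))) '' (A : Set _)))
          (Ideal.Quotient.mk (Ideal.span (Set.range Fs)) (monomial m (1 : k)))),
      Function.Surjective φ ∧
      ∀ q : MvPolynomial (Fin n) k, (φ q).val = aeval (fun i : Fin n => algebraMap (MvPolynomial (Fin n) k ⧸ Ideal.span (Set.range Fs))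
          (Localization.Away (Ideal.Quotient.mk (Ideal.span (Set.range Fs)) (monomial m (1 : k))))
          (Ideal.Quotient.mk (Ideal.span (Set.range Fs)) (monomial (a i) (1 : k))) *
          IsLocalization.Away.invSelf (Ideal.Quotient.mk (Ideal.span (Set.range Fs)) (monomial m (1 : k)))) q := by
  have hrange := CIChartPresentationRange.range_psi_eq_blowupAlgebra (Ideal.span (Set.range Fs)) V hV m a hgen A haA hge
  have hmemB : ∀ q, aeval (fun i : Fin n => algebraMap (MvPolynomial (Fin n) k ⧸ Ideal.span (Set.range Fs))
          (Localization.Away (Ideal.Quotient.mk (Ideal.span (Set.range Fs)) (monomial m (1 : k))))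
          (Ideal.Quotient.mk (Ideal.span (Set.range Fs)) (monomial (a i) (1 : k))) *
          IsLocalization.Away.invSelf (Ideal.Quotient.mk (Ideal.span (Set.range Fs)) (monomial m (1 : k)))) q ∈ blowupAlgebra
          (Ideal.span ((fun e : Fin n →₀ ℕ => Ideal.Quotient.mk (Ideal.span (Set.range Fs)) (monomial e (1 : k))) '' (A : Set _)))
          (Ideal.Quotient.mk (Ideal.span (Set.range Fs)) (monomial m (1 : k))) := fun q => by
    rw [← SetLike.mem_coe, ← hrange]; exact ⟨q, rfl⟩
  refine ⟨{ toFun := fun q => ⟨_, hmemB q⟩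
            map_one' := Subtype.ext (by simp)
            map_mul' := fun x y => Subtype.ext (by simp)
            map_zero' := Subtype.ext (by simp)
            map_add' := fun x y => Subtype.ext (by simp) }, ?_, fun q => rfl⟩
  rintro ⟨y, hy⟩
  rw [← SetLike.mem_coe, ← hrange] at hy
  obtain ⟨q, rfl⟩ := hy
  exact ⟨q, rfl⟩

include hV hgen hθF hunit in
/-- **The kernel sandwich** for any corestriction `φ` of `Ψ_F` (`φ q = Ψ_F q`): `(g₁, …, g_c) ⊆ ker φ ⊆ ((g₁, …, g_c) : Y^∞)`
(`CIChartPresentationKernel.psi_eq_zero_of_theta_eq`, `…exists_monomial_mul_mem_map_of_psi_eq_zero`; the total transform lies in `(g)`).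
[folklore] -/
theorem span_le_ker_and_sat {B' : Type} [CommRing B'] (φ : MvPolynomial (Fin n) k →+* B')
    (hker : ∀ h : MvPolynomial (Fin n) k, h ∈ RingHom.ker φ ↔ aeval (fun i : Fin n => algebraMap (MvPolynomial (Fin n) k ⧸ Ideal.span (Set.range Fs))
          (Localization.Away (Ideal.Quotient.mk (Ideal.span (Set.range Fs)) (monomial m (1 : k))))
          (Ideal.Quotient.mk (Ideal.span (Set.range Fs)) (monomial (a i) (1 : k))) *
          IsLocalization.Away.invSelf (Ideal.Quotient.mk (Ideal.span (Set.range Fs)) (monomial m (1 : k)))) h = 0) :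
    Ideal.span (Set.range gs) ≤ RingHom.ker φ ∧
      ∀ h ∈ RingHom.ker φ, ∃ e : Fin n →₀ ℕ, monomial e (1 : k) * h ∈ Ideal.span (Set.range gs) := by
  have hmapF : (Ideal.span (Set.range Fs)).map
      (aeval (fun j : Fin n => ∏ l : Fin n, (X l : MvPolynomial (Fin n) k) ^ V l j)).toRingHom ≤ Ideal.span (Set.range gs) := by
    rw [Ideal.map_span, Ideal.span_le]
    rintro _ ⟨_, ⟨i, rfl⟩, rfl⟩
    change aeval (fun j : Fin n => ∏ l : Fin n, (X l : MvPolynomial (Fin n) k) ^ V l j) (Fs i) ∈ Ideal.span (Set.range gs)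
    rw [hθF i]
    exact Ideal.mul_mem_left _ _ (Ideal.subset_span ⟨i, rfl⟩)
  refine ⟨?_, fun h hh => ?_⟩
  · rw [Ideal.span_le]
    rintro _ ⟨i, rfl⟩
    rw [SetLike.mem_coe, hker]
    exact CIChartPresentationKernel.psi_eq_zero_of_theta_eq (Ideal.span (Set.range Fs)) V hV m a hgen
      (Ideal.subset_span ⟨i, rfl⟩) (hθF i) (hunit i)
  · obtain ⟨e, he⟩ := CIChartPresentationKernel.exists_monomial_mul_mem_map_of_psi_eq_zero (Ideal.span (Set.range Fs)) V m a
      hgen h ((hker h).mp hh)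
    exact ⟨e, hmapF he⟩

include hV hgen hθF hunit in
/-- **THE LOCAL PRESENTATION OF THE STRICT TRANSFORM (C1ᶜⁱ).** Let `φ : k[Y] ↠ B = R[I_A R/x̄^m]` (`R = k[X]/(F₁, …, F_c)`) be a surjective
corestriction of the chart map (`(φ q) = Ψ_F q`; one exists by `exists_corestriction`; then `(g₁, …, g_c) ⊆ ker φ ⊆ ((g₁, …, g_c) : Y^∞)` by
`span_le_ker_and_sat`). For every prime `Q` of `B`, writing `Q̃ = φ⁻¹(Q)` and `S = k[Y]_Q̃`: if every variable `Yᵢ ∈ Q̃` is a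
non-zero-divisor on `S ⧸ (g₁, …, g_c)S` (discharged from the expected dimension by `isSMulRegular_algebraMap_X_of_expectedDim`), then
`B_Q ≃+* S ⧸ (g₁, …, g_c)S` — the `S ⧸ (gs)` of `CIChartCore.ciChartCore'`. No saturation binder. [folklore] -/
theorem nonempty_localization_ringEquiv (φ : MvPolynomial (Fin n) k →+* ↥(blowupAlgebra
          (Ideal.span ((fun e : Fin n →₀ ℕ => Ideal.Quotient.mk (Ideal.span (Set.range Fs)) (monomial e (1 : k))) '' (A : Set _)))
          (Ideal.Quotient.mk (Ideal.span (Set.range Fs)) (monomial m (1 : k)))))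
    (hsurj : Function.Surjective φ) (hφ : ∀ q : MvPolynomial (Fin n) k, (φ q).val = aeval (fun i : Fin n => algebraMap (MvPolynomial (Fin n) k ⧸ Ideal.span (Set.range Fs))
          (Localization.Away (Ideal.Quotient.mk (Ideal.span (Set.range Fs)) (monomial m (1 : k))))
          (Ideal.Quotient.mk (Ideal.span (Set.range Fs)) (monomial (a i) (1 : k))) *
          IsLocalization.Away.invSelf (Ideal.Quotient.mk (Ideal.span (Set.range Fs)) (monomial m (1 : k)))) q)
    (Q : Ideal ↥(blowupAlgebra
          (Ideal.span ((fun e : Fin n →₀ ℕ => Ideal.Quotient.mk (Ideal.span (Set.range Fs)) (monomial e (1 : k))) '' (A : Set _)))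
          (Ideal.Quotient.mk (Ideal.span (Set.range Fs)) (monomial m (1 : k))))) [Q.IsPrime]
    (hX : ∀ i : Fin n, (X i : MvPolynomial (Fin n) k) ∈ Q.comap φ →
      IsSMulRegular (Localization.AtPrime (Q.comap φ) ⧸ (Ideal.span (Set.range gs)).map
          (algebraMap (MvPolynomial (Fin n) k) (Localization.AtPrime (Q.comap φ))))
        (algebraMap (MvPolynomial (Fin n) k) (Localization.AtPrime (Q.comap φ)) (X i))) :
    Nonempty (Localization.AtPrime Q ≃+*
      Localization.AtPrime (Q.comap φ) ⧸ (Ideal.span (Set.range gs)).map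
        (algebraMap (MvPolynomial (Fin n) k) (Localization.AtPrime (Q.comap φ)))) := by
  have hker : ∀ h : MvPolynomial (Fin n) k, h ∈ RingHom.ker φ ↔ aeval (fun i : Fin n => algebraMap (MvPolynomial (Fin n) k ⧸ Ideal.span (Set.range Fs))
          (Localization.Away (Ideal.Quotient.mk (Ideal.span (Set.range Fs)) (monomial m (1 : k))))
          (Ideal.Quotient.mk (Ideal.span (Set.range Fs)) (monomial (a i) (1 : k))) *
          IsLocalization.Away.invSelf (Ideal.Quotient.mk (Ideal.span (Set.range Fs)) (monomial m (1 : k)))) h = 0 := fun h => by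
    rw [RingHom.mem_ker, Subtype.ext_iff, hφ]
    rfl
  have hks := span_le_ker_and_sat V hV m a hgen Fs gs d hθF hunit φ hker
  exact nonempty_localization_ringEquiv_quotient φ hsurj (Ideal.span (Set.range gs)) hks.1 hks.2 Q hX

/-- **The binder from the expected dimension** (for use with `nonempty_localization_ringEquiv`): at a prime `Q̃` of `k[Y]`, if the strict
transforms `gs` and the orbit coordinates `ys ⊇ {Yᵢ : Yᵢ ∈ Q̃}` (lists of elements of `𝔪_S`, `S = k[Y]_Q̃`) have the expected dimension
`dim S⧸(gs ++ ys) + |gs| + |ys| = dim S`, then every `Yᵢ ∈ Q̃` is a non-zero-divisor on `S ⧸ (g₁, …, g_c)S` (`isSMulRegular_of_expectedDim`).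
[folklore] -/
theorem isSMulRegular_algebraMap_X_of_expectedDim (Q : Ideal (MvPolynomial (Fin n) k)) [Q.IsPrime]
    [IsRegularLocalRing (Localization.AtPrime Q)] (ys : List (Localization.AtPrime Q))
    (hys : ∀ y ∈ ys, y ∈ maximalIdeal (Localization.AtPrime Q))
    (hgsm : ∀ i : Fin c, algebraMap (MvPolynomial (Fin n) k) (Localization.AtPrime Q) (gs i) ∈ maximalIdeal (Localization.AtPrime Q))
    (hXys : ∀ i : Fin n, (X i : MvPolynomial (Fin n) k) ∈ Q → algebraMap (MvPolynomial (Fin n) k) (Localization.AtPrime Q) (X i) ∈ ys)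
    (hdim : ringKrullDim (Localization.AtPrime Q ⧸ Ideal.ofList
        (List.ofFn (fun i : Fin c => algebraMap (MvPolynomial (Fin n) k) (Localization.AtPrime Q) (gs i)) ++ ys)) +
      ((c + ys.length : ℕ) : WithBot ℕ∞) = ringKrullDim (Localization.AtPrime Q)) :
    ∀ i : Fin n, (X i : MvPolynomial (Fin n) k) ∈ Q →
      IsSMulRegular (Localization.AtPrime Q ⧸ (Ideal.span (Set.range gs)).map
          (algebraMap (MvPolynomial (Fin n) k) (Localization.AtPrime Q)))
        (algebraMap (MvPolynomial (Fin n) k) (Localization.AtPrime Q) (X i)) := by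
  intro i hi
  have hgs'm : ∀ g ∈ List.ofFn (fun j : Fin c => algebraMap (MvPolynomial (Fin n) k) (Localization.AtPrime Q) (gs j)),
      g ∈ maximalIdeal (Localization.AtPrime Q) := by
    intro g hg
    rw [List.mem_ofFn] at hg
    obtain ⟨j, rfl⟩ := hg
    exact hgsm j
  have hdim' : ringKrullDim (Localization.AtPrime Q ⧸ Ideal.ofList
      (List.ofFn (fun j : Fin c => algebraMap (MvPolynomial (Fin n) k) (Localization.AtPrime Q) (gs j)) ++ ys)) +
      (((List.ofFn (fun j : Fin c => algebraMap (MvPolynomial (Fin n) k) (Localization.AtPrime Q) (gs j))).length +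
        ys.length : ℕ) : WithBot ℕ∞) = ringKrullDim (Localization.AtPrime Q) := by
    rw [List.length_ofFn]; exact hdim
  have hreg := isSMulRegular_of_expectedDim _ ys hgs'm hys hdim' _ (hXys i hi)
  have hideal : Ideal.ofList (List.ofFn (fun j : Fin c => algebraMap (MvPolynomial (Fin n) k) (Localization.AtPrime Q) (gs j))) =
      (Ideal.span (Set.range gs)).map (algebraMap (MvPolynomial (Fin n) k) (Localization.AtPrime Q)) := by
    rw [Ideal.map_span, ← Set.range_comp]
    change Ideal.span {r | r ∈ List.ofFn (fun j : Fin c => algebraMap (MvPolynomial (Fin n) k) (Localization.AtPrime Q) (gs j))} = _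
    congr 1
    ext r
    rw [Set.mem_setOf_eq, List.mem_ofFn]
    rfl
  rw [← hideal]
  exact hreg

end Chart

end Summit.ResolutionOfSingularities.ResolutionOfSingularities.Theorems.FInjectiveMacaulayfication.CIChartPresentationLocal

end
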